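import Summits.QuantumFields.YangMills.Theorems.PoincareLipschitzCovariantCaccioppoli
import Summits.QuantumFields.YangMills.Theorems.PoincareLipschitzSphereMapBoxAverageLetters

/-!
# Line «poincare_lipschitz» on crux `HistoryTailL` (stmt-QuantumFields-19936), route crux `BlockLipschitzL` (stmt-QuantumFields-23533), K2 organ of record LOC-REG-MIN —
# FLAT SHADOW «ENERGY → RANGE» (E→R) FOR LATTICE MINIMISERS INTO A SPHERE, FILE 5c: THE INTERIOR DIRICHLET COMPARISON —
# Pythagoras for the vector Dirichlet data on a box, the Dirichlet principle, Cauchy–Schwarz for the bond energy, and the abstract one-step comparison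
# `E(u − h′; Q_R) ≤ Λ + (m⁻² − 1)·E(u; Q_R) + m⁻²·(2√(E(u;Q_R)·X) + X)`, `X = E(c − u; Q_R)`

Cell `ym3-torus` (YM ladder rung R3 = continuum SU(2) Yang–Mills on the three-torus — a RUNG, NOT the Clay problem: not d = 4, not infinite volume, not a mass gap); width seat
`ym-ust-19936-w5` gen 12 (LEAD ym-ust-19936-w1 g8 2026-08-29T05:29:02Z END-GAME «[C] = E→R F5 (★w5) + F6»; my LOCATE `E2R-ROAD-w5g12.md` §2 (vi)–(vii), §3 F5).
THEOREMS ONLY (def-free; the bond energy is written `Σ_{y∈Q_R(z)} Σ_μ ‖f(y+e_μ) − f y‖²` in place), values in any real inner-product space `V`, lattice letters of lit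
✓`B4Eq19LatticeOperators`; uses px7 g4's ✓`PoincareLipschitzCovariantCaccioppoli.sum_inner_covLop` AT THE TRIVIAL TRANSPORT (vector summation by parts) and ★w5 g12's
✓`PoincareLipschitzSphereMapBoxAverageLetters.energy_normalize_le`; `--supports stmt-QuantumFields-19936`.  Nothing here proves E→R, LOC-REG-MIN, `hReg`, a stub,
`BlockLipschitzL`, `HistoryTailL` or a summit statement; nothing twisted ∕ covariant is in this file.

THE ABSTRACT ONE-STEP COMPARISON (§3).  Data on the box `Q_R(z)` (`R ≥ 1`): the field `u`; a «mollified» field `c` (ANY field — the assembler takes the variable-radius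
mollifier of F4∕F5a); `h′` componentwise harmonic on `Q_{R−1}(z)` with `h′ = u` off `Q_{R−1}(z)`; `H` componentwise harmonic on `Q_{R−1}(z)` with `H = c` off `Q_{R−1}(z)`,
`‖H‖ ≥ m > 0` on `Q_{R+1}(z)`; and the MINIMALITY INEQUALITY in the form the assembler delivers it, `E(u; Q_R) ≤ Λ + E(π∘H; Q_R)` (`π v = v∕‖v‖`; `Λ` = the layer cost).
THEN `E(u − h′; Q_R) ≤ Λ + (m⁻² − 1)·E(u; Q_R) + m⁻²·(2·√(E(u; Q_R)·X) + X)` with `X := E(c − u; Q_R)` — the inequality that, with px7's ✓`vec_harmonic_decay` for `h′`,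
IS the one-step energy improvement (`E(u;Q_ρ) ≤ 2E(h′;Q_ρ) + 2E(u − h′;Q_R)`).  Chain: `E(u) ≤ Λ + E(πH) ≤ Λ + m⁻²E(H)` (projection) `≤ Λ + m⁻²E(h′ + (c − u))` (DIRICHLET
PRINCIPLE: `h′ + (c − u) = H` off `Q_{R−1}`) `≤ Λ + m⁻²(E(h′) + 2√(E(h′)X) + X)` (Cauchy–Schwarz) and `E(u) = E(h′) + E(u − h′)` (PYTHAGORAS), `E(h′) ≤ E(u)`.
* §1 ★ `energy_add_eq_of_harmonic` (PYTHAGORAS: `h` harmonic on `Q_{R−1}(z)`, `w = 0` off `Q_{R−1}(z)` ⟹ `E(h + w; Q_R) = E(h; Q_R) + E(w; Q_R)`, via ✓`sum_inner_covLop` at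
  `τ ≡ refl`), ★ `energy_eq_of_eq_off` (`v = h` off `Q_{R−1}` ⟹ `E(v) = E(h) + E(v − h)`), ★ `dirichlet_principle` (`E(h; Q_R) ≤ E(v; Q_R)`), `energy_sub_harmonic_le`
  (`E(v − h) ≤ E(v)`, `E(h) ≤ E(v)`);
* §2 `sum_sum_inner_le_sqrt` (Cauchy–Schwarz for the bond pairing), ★ `energy_add_le` (`E(f + g) ≤ E(f) + 2√(E(f)E(g)) + E(g)`);
* §3 ★★★ `interior_comparison` — the abstract one-step comparison above.
[folklore] ([SchoenUhlenbeck1982] §4 (energy improvement for minimisers by harmonic replacement); [Giaquinta1984] Ch. III §2 (Dirichlet principle); the lattice statements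
are this file's).
-/

set_option autoImplicit false

noncomputable section

open scoped BigOperators InnerProductSpace
open Finset

namespace Summit.QuantumFields.YangMills.Theorems.PoincareLipschitzSphereMapInteriorComparison

open Literature.MathematicalPhysics.QuantumFieldTheory.Balaban1983to89
open B4Eq19LatticeOperators
open Summit.QuantumFields.YangMills.Theorems.PoincareLipschitzCovariantCaccioppoli (sum_inner_covLop)
open Summit.QuantumFields.YangMills.Theorems.PoincareLipschitzSphereMapBoxAverageLetters (energy_normalize_le)

variable {d : ℕ} {V : Type*} [NormedAddCommGroup V] [InnerProductSpace ℝ V]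

/-! ## §1 Pythagoras and the Dirichlet principle for the vector Dirichlet problem on a box -/

/-- **VECTOR SUMMATION BY PARTS (flat)**: for `w` vanishing off `Q_{R−1}(z)`,
`Σ_{Q_R} Σ_μ ⟪h(y+e_μ) − h y, w(y+e_μ) − w y⟫ = Σ_{Q_R} ⟪w y, Σ_μ ((h y + h y) − h(y−e_μ) − h(y+e_μ))⟫` — ✓`sum_inner_covLop` at the trivial transport. [folklore]
[cite: Giaquinta1984, Ch. III §2 (2.3) p.77] -/
theorem sum_sum_inner_fdiff_eq (h w : Zd d → V) (z : Zd d) (R : ℤ) (hw : ∀ y ∉ box z (R - 1), w y = 0) :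
    ∑ y ∈ box z R, ∑ μ, ⟪h (y + unitVec μ) - h y, w (y + unitVec μ) - w y⟫_ℝ =
      ∑ y ∈ box z R, ⟪w y, ∑ μ, ((h y + h y) - h (y - unitVec μ) - h (y + unitVec μ))⟫_ℝ := by
  have h0 := sum_inner_covLop (fun _ _ => LinearIsometryEquiv.refl ℝ V) 0 w h z R hw
  have hs : (LinearIsometryEquiv.refl ℝ V).symm = LinearIsometryEquiv.refl ℝ V := rfl
  simp only [hs, LinearIsometryEquiv.coe_refl, id, zero_smul, add_zero, zero_mul] at h0
  rw [h0]
  exact Finset.sum_congr rfl fun y _ => Finset.sum_congr rfl fun μ _ => real_inner_comm _ _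

/-- ★ **PYTHAGORAS**: `h` componentwise harmonic on `Q_{R−1}(z)` and `w = 0` off `Q_{R−1}(z)` ⟹ `E(h + w; Q_R) = E(h; Q_R) + E(w; Q_R)`. [folklore]
[cite: Giaquinta1984, Ch. III §2 p.78 (Dirichlet principle)] -/
theorem energy_add_eq_of_harmonic (h w : Zd d → V) (z : Zd d) (R : ℤ)
    (hh : ∀ y ∈ box z (R - 1), ∑ μ, ((h y + h y) - h (y - unitVec μ) - h (y + unitVec μ)) = 0) (hw : ∀ y ∉ box z (R - 1), w y = 0) :
    ∑ y ∈ box z R, ∑ μ, ‖(h (y + unitVec μ) + w (y + unitVec μ)) - (h y + w y)‖ ^ 2 =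
      ∑ y ∈ box z R, ∑ μ, ‖h (y + unitVec μ) - h y‖ ^ 2 + ∑ y ∈ box z R, ∑ μ, ‖w (y + unitVec μ) - w y‖ ^ 2 := by
  have hcross : ∑ y ∈ box z R, ∑ μ, ⟪h (y + unitVec μ) - h y, w (y + unitVec μ) - w y⟫_ℝ = 0 := by
    rw [sum_sum_inner_fdiff_eq h w z R hw]
    refine Finset.sum_eq_zero fun y hy => ?_
    by_cases hyb : y ∈ box z (R - 1)
    · rw [hh y hyb, inner_zero_right]
    · rw [hw y hyb, inner_zero_left]
  have hterm : ∀ y μ, ‖(h (y + unitVec μ) + w (y + unitVec μ)) - (h y + w y)‖ ^ 2 =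
      ‖h (y + unitVec μ) - h y‖ ^ 2 + 2 * ⟪h (y + unitVec μ) - h y, w (y + unitVec μ) - w y⟫_ℝ + ‖w (y + unitVec μ) - w y‖ ^ 2 := by
    intro y μ
    have e : (h (y + unitVec μ) + w (y + unitVec μ)) - (h y + w y) = (h (y + unitVec μ) - h y) + (w (y + unitVec μ) - w y) := by abel
    rw [e, @norm_add_sq_real]
  simp_rw [hterm, Finset.sum_add_distrib, ← Finset.mul_sum]
  rw [hcross, mul_zero, add_zero]

/-- ★ **PYTHAGORAS, DATA FORM**: `h` componentwise harmonic on `Q_{R−1}(z)`, `v = h` off `Q_{R−1}(z)` ⟹ `E(v; Q_R) = E(h; Q_R) + E(v − h; Q_R)`. [folklore]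
[cite: Giaquinta1984, Ch. III §2 p.78] -/
theorem energy_eq_of_eq_off (h v : Zd d → V) (z : Zd d) (R : ℤ)
    (hh : ∀ y ∈ box z (R - 1), ∑ μ, ((h y + h y) - h (y - unitVec μ) - h (y + unitVec μ)) = 0) (hv : ∀ y ∉ box z (R - 1), v y = h y) :
    ∑ y ∈ box z R, ∑ μ, ‖v (y + unitVec μ) - v y‖ ^ 2 =
      ∑ y ∈ box z R, ∑ μ, ‖h (y + unitVec μ) - h y‖ ^ 2 + ∑ y ∈ box z R, ∑ μ, ‖(v (y + unitVec μ) - h (y + unitVec μ)) - (v y - h y)‖ ^ 2 := by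
  have h1 := energy_add_eq_of_harmonic h (fun y => v y - h y) z R hh (fun y hy => by simp [hv y hy])
  have e : ∀ y μ, (h (y + unitVec μ) + (v (y + unitVec μ) - h (y + unitVec μ))) - (h y + (v y - h y)) = v (y + unitVec μ) - v y := by
    intro y μ; abel
  simp_rw [e] at h1
  exact h1

/-- ★ **THE DIRICHLET PRINCIPLE**: the componentwise harmonic function minimises the bond energy among fields with the same values off `Q_{R−1}(z)`:
`E(h; Q_R) ≤ E(v; Q_R)`. [folklore] [cite: Giaquinta1984, Ch. III §2 p.78] -/
theorem dirichlet_principle (h v : Zd d → V) (z : Zd d) (R : ℤ)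
    (hh : ∀ y ∈ box z (R - 1), ∑ μ, ((h y + h y) - h (y - unitVec μ) - h (y + unitVec μ)) = 0) (hv : ∀ y ∉ box z (R - 1), v y = h y) :
    ∑ y ∈ box z R, ∑ μ, ‖h (y + unitVec μ) - h y‖ ^ 2 ≤ ∑ y ∈ box z R, ∑ μ, ‖v (y + unitVec μ) - v y‖ ^ 2 := by
  rw [energy_eq_of_eq_off h v z R hh hv]
  have : 0 ≤ ∑ y ∈ box z R, ∑ μ : Fin d, ‖(v (y + unitVec μ) - h (y + unitVec μ)) - (v y - h y)‖ ^ 2 :=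
    Finset.sum_nonneg fun _ _ => Finset.sum_nonneg fun _ _ => by positivity
  linarith

/-- **The defect part is bounded by the whole**: `E(v − h; Q_R) ≤ E(v; Q_R)` under the same hypotheses. [folklore] -/
theorem energy_sub_harmonic_le (h v : Zd d → V) (z : Zd d) (R : ℤ)
    (hh : ∀ y ∈ box z (R - 1), ∑ μ, ((h y + h y) - h (y - unitVec μ) - h (y + unitVec μ)) = 0) (hv : ∀ y ∉ box z (R - 1), v y = h y) :
    ∑ y ∈ box z R, ∑ μ, ‖(v (y + unitVec μ) - h (y + unitVec μ)) - (v y - h y)‖ ^ 2 ≤ ∑ y ∈ box z R, ∑ μ, ‖v (y + unitVec μ) - v y‖ ^ 2 := by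
  rw [energy_eq_of_eq_off h v z R hh hv]
  have : 0 ≤ ∑ y ∈ box z R, ∑ μ : Fin d, ‖h (y + unitVec μ) - h y‖ ^ 2 := Finset.sum_nonneg fun _ _ => Finset.sum_nonneg fun _ _ => by positivity
  linarith

/-! ## §2 Cauchy–Schwarz for the bond energy -/

/-- `Σ_{y∈Q} Σ_μ ⟪a y μ, b y μ⟫ ≤ √(Σ_QΣ_μ‖a‖²)·√(Σ_QΣ_μ‖b‖²)`. [folklore] -/
theorem sum_sum_inner_le_sqrt (Q : Finset (Zd d)) (a b : Zd d → Fin d → V) :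
    ∑ y ∈ Q, ∑ μ, ⟪a y μ, b y μ⟫_ℝ ≤ Real.sqrt (∑ y ∈ Q, ∑ μ, ‖a y μ‖ ^ 2) * Real.sqrt (∑ y ∈ Q, ∑ μ, ‖b y μ‖ ^ 2) := by
  rw [← Finset.sum_product', ← Finset.sum_product' (f := fun y μ => ‖a y μ‖ ^ 2), ← Finset.sum_product' (f := fun y μ => ‖b y μ‖ ^ 2)]
  set P := Q ×ˢ (Finset.univ : Finset (Fin d)) with hP
  have h1 : ∑ p ∈ P, ⟪a p.1 p.2, b p.1 p.2⟫_ℝ ≤ ∑ p ∈ P, ‖a p.1 p.2‖ * ‖b p.1 p.2‖ :=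
    Finset.sum_le_sum fun p _ => real_inner_le_norm _ _
  have h2 : (∑ p ∈ P, ‖a p.1 p.2‖ * ‖b p.1 p.2‖) ^ 2 ≤ (∑ p ∈ P, ‖a p.1 p.2‖ ^ 2) * (∑ p ∈ P, ‖b p.1 p.2‖ ^ 2) :=
    Finset.sum_mul_sq_le_sq_mul_sq P (fun p => ‖a p.1 p.2‖) (fun p => ‖b p.1 p.2‖)
  have hA : 0 ≤ ∑ p ∈ P, ‖a p.1 p.2‖ ^ 2 := Finset.sum_nonneg fun _ _ => by positivity
  have hB : 0 ≤ ∑ p ∈ P, ‖b p.1 p.2‖ ^ 2 := Finset.sum_nonneg fun _ _ => by positivity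
  have h0 : 0 ≤ ∑ p ∈ P, ‖a p.1 p.2‖ * ‖b p.1 p.2‖ := Finset.sum_nonneg fun _ _ => by positivity
  have h3 : ∑ p ∈ P, ‖a p.1 p.2‖ * ‖b p.1 p.2‖ ≤ Real.sqrt (∑ p ∈ P, ‖a p.1 p.2‖ ^ 2) * Real.sqrt (∑ p ∈ P, ‖b p.1 p.2‖ ^ 2) := by
    rw [← Real.sqrt_mul hA, ← Real.sqrt_sq h0]
    exact Real.sqrt_le_sqrt h2
  exact h1.trans h3

/-- ★ **`E(f + g; Q) ≤ E(f; Q) + 2·√(E(f; Q)·E(g; Q)) + E(g; Q)`** for the bond energy on any finite set of sites. [folklore] -/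
theorem energy_add_le (Q : Finset (Zd d)) (f g : Zd d → V) :
    ∑ y ∈ Q, ∑ μ, ‖(f (y + unitVec μ) + g (y + unitVec μ)) - (f y + g y)‖ ^ 2 ≤
      ∑ y ∈ Q, ∑ μ, ‖f (y + unitVec μ) - f y‖ ^ 2 +
        2 * Real.sqrt ((∑ y ∈ Q, ∑ μ, ‖f (y + unitVec μ) - f y‖ ^ 2) * (∑ y ∈ Q, ∑ μ, ‖g (y + unitVec μ) - g y‖ ^ 2)) +
        ∑ y ∈ Q, ∑ μ, ‖g (y + unitVec μ) - g y‖ ^ 2 := by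
  have hterm : ∀ y μ, ‖(f (y + unitVec μ) + g (y + unitVec μ)) - (f y + g y)‖ ^ 2 =
      ‖f (y + unitVec μ) - f y‖ ^ 2 + 2 * ⟪f (y + unitVec μ) - f y, g (y + unitVec μ) - g y⟫_ℝ + ‖g (y + unitVec μ) - g y‖ ^ 2 := by
    intro y μ
    have e : (f (y + unitVec μ) + g (y + unitVec μ)) - (f y + g y) = (f (y + unitVec μ) - f y) + (g (y + unitVec μ) - g y) := by abel
    rw [e, @norm_add_sq_real]
  simp_rw [hterm, Finset.sum_add_distrib, ← Finset.mul_sum]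
  have hcs := sum_sum_inner_le_sqrt Q (fun y μ => f (y + unitVec μ) - f y) (fun y μ => g (y + unitVec μ) - g y)
  have hA : 0 ≤ ∑ y ∈ Q, ∑ μ : Fin d, ‖f (y + unitVec μ) - f y‖ ^ 2 := Finset.sum_nonneg fun _ _ => Finset.sum_nonneg fun _ _ => by positivity
  rw [Real.sqrt_mul hA]
  linarith

/-! ## §3 The abstract one-step comparison -/

/-- ★★★ **THE INTERIOR DIRICHLET COMPARISON.**  `R` any; `u, c, h′, H : ℤ^d → V`; `h′` componentwise harmonic on `Q_{R−1}(z)` with `h′ = u` off `Q_{R−1}(z)`; `H`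
componentwise harmonic on `Q_{R−1}(z)` with `H = c` off `Q_{R−1}(z)` and `‖H‖ ≥ m` (`0 < m ≤ 1`) on `Q_R(z)` and on its forward neighbours; and the MINIMALITY INEQUALITY
`E(u; Q_R) ≤ Λ + E(π∘H; Q_R)` (`π v = ‖v‖⁻¹ • v`).  THEN, with `E = E(u; Q_R(z))` and `X = E(c − u; Q_R(z))`:
`E(u − h′; Q_R(z)) ≤ Λ + (m⁻² − 1)·E + m⁻²·(2·√(E·X) + X)`.
For `m = 1 − η` close to `1`, `Λ` and `X` small against `E` this is the ENERGY IMPROVEMENT `E(u − h′) ≤ δ·E`; with px7's ✓`vec_harmonic_decay` for `h′` it gives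
`E(u; Q_ρ) ≤ (2A_d((ρ+1)∕R)^d + 2δ)·E` — the socket `hone` of px8's ✓`…SmallRangeOfOneStep`. [folklore]
[cite: SchoenUhlenbeck1982, §4 (energy improvement by harmonic replacement); Giaquinta1984, Ch. III §2 p.78] -/
theorem interior_comparison (u c h' H : Zd d → V) (z : Zd d) (R : ℤ) {m Λ : ℝ} (hm : 0 < m) (hm1 : m ≤ 1)
    (hh' : ∀ y ∈ box z (R - 1), ∑ μ, ((h' y + h' y) - h' (y - unitVec μ) - h' (y + unitVec μ)) = 0) (hh'u : ∀ y ∉ box z (R - 1), h' y = u y)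
    (hH : ∀ y ∈ box z (R - 1), ∑ μ, ((H y + H y) - H (y - unitVec μ) - H (y + unitVec μ)) = 0) (hHc : ∀ y ∉ box z (R - 1), H y = c y)
    (hmQ : ∀ y ∈ box z R, m ≤ ‖H y‖) (hmQ' : ∀ y ∈ box z R, ∀ μ : Fin d, m ≤ ‖H (y + unitVec μ)‖)
    (hmin : ∑ y ∈ box z R, ∑ μ, ‖u (y + unitVec μ) - u y‖ ^ 2 ≤
      Λ + ∑ y ∈ box z R, ∑ μ, ‖(‖H (y + unitVec μ)‖)⁻¹ • H (y + unitVec μ) - (‖H y‖)⁻¹ • H y‖ ^ 2) :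
    ∑ y ∈ box z R, ∑ μ, ‖(u (y + unitVec μ) - h' (y + unitVec μ)) - (u y - h' y)‖ ^ 2 ≤
      Λ + ((m ^ 2)⁻¹ - 1) * ∑ y ∈ box z R, ∑ μ, ‖u (y + unitVec μ) - u y‖ ^ 2 +
        (m ^ 2)⁻¹ * (2 * Real.sqrt ((∑ y ∈ box z R, ∑ μ, ‖u (y + unitVec μ) - u y‖ ^ 2) *
            (∑ y ∈ box z R, ∑ μ, ‖(c (y + unitVec μ) - u (y + unitVec μ)) - (c y - u y)‖ ^ 2)) +
          ∑ y ∈ box z R, ∑ μ, ‖(c (y + unitVec μ) - u (y + unitVec μ)) - (c y - u y)‖ ^ 2) := by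
  set E : ℝ := ∑ y ∈ box z R, ∑ μ, ‖u (y + unitVec μ) - u y‖ ^ 2 with hE
  set Eh : ℝ := ∑ y ∈ box z R, ∑ μ, ‖h' (y + unitVec μ) - h' y‖ ^ 2 with hEh
  set EH : ℝ := ∑ y ∈ box z R, ∑ μ, ‖H (y + unitVec μ) - H y‖ ^ 2 with hEH
  set X : ℝ := ∑ y ∈ box z R, ∑ μ, ‖(c (y + unitVec μ) - u (y + unitVec μ)) - (c y - u y)‖ ^ 2 with hX
  set D : ℝ := ∑ y ∈ box z R, ∑ μ, ‖(u (y + unitVec μ) - h' (y + unitVec μ)) - (u y - h' y)‖ ^ 2 with hD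
  have hX0 : 0 ≤ X := Finset.sum_nonneg fun _ _ => Finset.sum_nonneg fun _ _ => by positivity
  have hEh0 : 0 ≤ Eh := Finset.sum_nonneg fun _ _ => Finset.sum_nonneg fun _ _ => by positivity
  have hm2 : 0 < (m ^ 2)⁻¹ := by positivity
  -- Pythagoras for `u = h' + (u − h')`
  have hP : E = Eh + D := energy_eq_of_eq_off h' u z R hh' (fun y hy => (hh'u y hy).symm)
  have hEhE : Eh ≤ E := by rw [hP]; linarith [show 0 ≤ D from Finset.sum_nonneg fun _ _ => Finset.sum_nonneg fun _ _ => by positivity]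
  -- projection: `E(πH) ≤ m⁻² E(H)`
  have hproj := energy_normalize_le (box z R) H hm hmQ hmQ'
  -- Dirichlet principle against the competitor `v = h' + (c − u)` (`= c = H` off `Q_{R−1}`)
  have hv : ∀ y ∉ box z (R - 1), (fun y => h' y + (c y - u y)) y = H y := by
    intro y hy; simp only [hh'u y hy, hHc y hy]; abel
  have hDP := dirichlet_principle H (fun y => h' y + (c y - u y)) z R hH hv
  -- Cauchy–Schwarz for `E(h' + (c − u))`
  have hCS := energy_add_le (box z R) h' (fun y => c y - u y)
  -- `E(h' + (c−u)) ≤ Eh + 2√(Eh X) + X ≤ Eh + 2√(E X) + X`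
  have hsqrt : Real.sqrt (Eh * X) ≤ Real.sqrt (E * X) := Real.sqrt_le_sqrt (mul_le_mul_of_nonneg_right hEhE hX0)
  have hv_le : ∑ y ∈ box z R, ∑ μ, ‖(h' (y + unitVec μ) + (c (y + unitVec μ) - u (y + unitVec μ))) - (h' y + (c y - u y))‖ ^ 2 ≤
      Eh + 2 * Real.sqrt (E * X) + X := hCS.trans (by linarith)
  -- chain
  have h1 : E ≤ Λ + (m ^ 2)⁻¹ * EH := hmin.trans (by linarith)
  have h2 : EH ≤ Eh + 2 * Real.sqrt (E * X) + X := hDP.trans hv_le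
  have h3 : E ≤ Λ + (m ^ 2)⁻¹ * (Eh + 2 * Real.sqrt (E * X) + X) := h1.trans (by nlinarith)
  -- `D = E − Eh`, and `(m⁻² − 1)·Eh ≤ (m⁻² − 1)·E` since `m ≤ 1`
  have hk : 0 ≤ (m ^ 2)⁻¹ - 1 := by
    have hm2le : m ^ 2 ≤ 1 := by nlinarith
    have : 1 ≤ (m ^ 2)⁻¹ := by rw [le_inv_comm₀ one_pos (by positivity)]; simpa using hm2le
    linarith
  have hk' := mul_le_mul_of_nonneg_left hEhE hk
  have hDeq : D = E - Eh := by linarith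
  rw [hDeq]
  nlinarith

end Summit.QuantumFields.YangMills.Theorems.PoincareLipschitzSphereMapInteriorComparison
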